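import Literature.Probability.RandomPlanarGeometry.SAWWedgeBoundedProfile
import Mathlib.Order.LiminfLimsup
import Mathlib.Analysis.SpecialFunctions.Pow.Real
import HarnessLib

/-!
# Walks in wedges, Madras–Slade Theorem 8.2.3 (a): the cases of an everywhere bounded profile and of a
# fjord-free cut (corner decomposition with a one-slice separator)

Topic `Literature/Probability/RandomPlanarGeometry` (continues `SAWWedgeBoundedProfile.lean`: Madras–Slade's wedge
`Zd.msWedge f = 𝓡_f = {x ∈ ℤ^d : x₁ ≥ 0, 0 ≤ x_i ≤ f_i(x₁)}`, `Zd.regionCount (msWedge f) N = c_N⟨𝓡_f⟩`, the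
lattice-free corner-decomposition engine `CornerDecomp.CornerData` / `CornerDecomp.card_regionWalks_le_pow`, the
slabs `CornerDecomp.slabAt i A` counted by `c_n(R[d-1,A])` (`CornerDecomp.card_envWalks_slabAt_le`), the envelope
`CornerDecomp.exists_tubeCount_le_mul_pow`, and Theorem 8.2.3 (a) in the forms `MadrasSlade1993_thm823a_two /
_finite / _of_ne_top / _of_forall`; `SAWTubeMonotonicity.lean`: (8.2.11) `μ(R[k,T]) < μ`).

Source: N. Madras, G. Slade, *The Self-Avoiding Walk* (Birkhäuser 1993), §8.2, Theorem 8.2.3 (a) (book p. 271):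
"Suppose `limsup_{x→∞} f_i(x) < ∞` for at least one `i`. Then `limsup_{N→∞} c_N⟨𝓡_f⟩^{1/N} < μ`." (printed proof:
"an immediate consequence of the Pattern Theorem"; attribution Notes §8.5 p. 278: Hammersley–Whittington 1985).
`SAWWedgeBoundedProfile.lean` proves (a) without the Pattern Theorem whenever the OTHER profiles are finite-valued
below the threshold of the bounded one (finite corner). This file enlarges the Pattern-Theorem-free range in two
directions:

* **`Zd.MadrasSlade1993_thm823a_of_bounded`** — profile `i` bounded EVERYWHERE (`f_i(x) ≤ T` for all `x`), the other
  profiles ARBITRARY (values `∞` allowed anywhere): then `𝓡_f` lies in the slab `{0 ≤ x_i ≤ T}` and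
  `limsup c_N⟨𝓡_f⟩^{1/N} ≤ μ(R[d-1,T]) < μ` by (8.2.11) — e.g. the quarter-slab `{x₁ ≥ 0, 0 ≤ x₂ ≤ T, x₃ ≥ 0}`
  (`f₂ ≡ T`, `f₃ ≡ ∞`), not covered by the finite-corner theorems.
* **`Zd.MadrasSlade1993_thm823a_of_cut`** — profile `i` eventually bounded (`f_i(x) ≤ T` for `x ≥ a`) and ONE
  "fjord-free cut" `c | c+1` beyond the threshold (`c ≥ a`): no other profile is infinite on BOTH slices `c` and
  `c+1`. Then the finite set `B = {0} ∪ {v ∈ 𝓡_f : v₁ = c, v + e₁ ∈ 𝓡_f}` separates `𝓡_f` into `{x₁ ≥ c+1}`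
  (inside the slab `{0 ≤ x_i ≤ T}`) and `{x₁ ≤ c} ∖ B` (inside the slab `{0 ≤ x₁ ≤ c}`), no lattice edge joining
  the two, and the corner-decomposition engine gives `c_N⟨𝓡_f⟩ ≤ C (N+1)^p ρ^N` with `ρ < μ`
  (`regionCount_msWedge_le_mul_pow_cut`), whence `limsup c_N⟨𝓡_f⟩^{1/N} < μ`.
  **`Zd.MadrasSlade1993_thm823a_of_frequently_cut`** — the same with the printed hypothesis `limsup f_i < ∞` and
  "fjord-free cuts beyond every threshold" (`∃ᶠ c, ∀ j ∉ {0,i}, f_j(c) ≠ ∞ ∨ f_j(c+1) ≠ ∞`); it contains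
  `MadrasSlade1993_thm823a_of_ne_top` (all values finite ⇒ every cut is fjord-free).

What remains of the printed (a) outside these theorems: `d ≥ 3`, `f_i` bounded only eventually (not from `x₁ = 0`),
and beyond some point EVERY cut `c | c+1` blocked by another profile infinite on both of its slices — a region with an
infinite interface between its two sub-`μ` parts, for which a covering (Pattern-Theorem) argument is needed.
Label: CONSOLIDATION — instances of the printed Theorem 8.2.3 (a) with a Pattern-Theorem-free proof; the printed proof
is not the one formalised (lit-2 g15, 2026-08-23).
-/

noncomputable section

open Finset Filter Topology Literature.Probability.LatticeModels Literature.Probability.Percolation SimpleGraph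
open scoped BigOperators

namespace Literature.Probability.RandomPlanarGeometry.SAW.Zd

variable {d : ℕ}

namespace CutSeparator

open CornerDecomp

/-! ### Analysis helpers (as in `SAWWedgeBoundedProfile.lean`, where they are private) -/

/-- If `0 ≤ c_N ≤ C (N+1)^p ρ^N` then `limsup_N c_N^{1/N} ≤ ρ`. [folklore] -/
private theorem limsup_rpow_le_of_le_mul_pow {c : ℕ → ℝ} {C ρ : ℝ} {p : ℕ} (hc : ∀ N, 0 ≤ c N) (hρ : 0 < ρ)
    (h : ∀ N, c N ≤ C * ((N : ℝ) + 1) ^ p * ρ ^ N) :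
    Filter.limsup (fun N : ℕ => c N ^ (1 / (N : ℝ))) atTop ≤ ρ := by
  refine le_of_forall_gt_imp_ge_of_dense fun ρ' hρ' => ?_
  have hρ'0 : 0 < ρ' := hρ.trans hρ'
  have hr : |ρ / ρ'| < 1 := by
    rw [abs_of_pos (div_pos hρ hρ'0), div_lt_one hρ'0]; exact hρ'
  have hlim : Tendsto (fun N : ℕ => |C| * 2 ^ p * ((N : ℝ) ^ p * (ρ / ρ') ^ N)) atTop (𝓝 0) := by
    have := (tendsto_pow_const_mul_const_pow_of_abs_lt_one p hr).const_mul (|C| * 2 ^ p)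
    rwa [mul_zero] at this
  have hev : ∀ᶠ N : ℕ in atTop, c N ^ (1 / (N : ℝ)) ≤ ρ' := by
    filter_upwards [(tendsto_order.1 hlim).2 1 one_pos, eventually_ge_atTop 1] with N hN hN1
    have hbound : C * ((N : ℝ) + 1) ^ p * (ρ / ρ') ^ N ≤ 1 := by
      have hN1' : (1 : ℝ) ≤ N := by exact_mod_cast hN1
      have h2 : ((N : ℝ) + 1) ^ p ≤ (2 : ℝ) ^ p * (N : ℝ) ^ p := by
        rw [← mul_pow]; exact pow_le_pow_left₀ (by positivity) (by linarith) p
      have hq : 0 ≤ (ρ / ρ') ^ N := by positivity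
      calc C * ((N : ℝ) + 1) ^ p * (ρ / ρ') ^ N ≤ |C| * ((N : ℝ) + 1) ^ p * (ρ / ρ') ^ N := by
            gcongr; exact le_abs_self C
        _ ≤ |C| * ((2 : ℝ) ^ p * (N : ℝ) ^ p) * (ρ / ρ') ^ N := by gcongr
        _ = |C| * 2 ^ p * ((N : ℝ) ^ p * (ρ / ρ') ^ N) := by ring
        _ ≤ 1 := hN.le
    have hcN : c N ≤ ρ' ^ N := by
      calc c N ≤ C * ((N : ℝ) + 1) ^ p * ρ ^ N := h N
        _ = (C * ((N : ℝ) + 1) ^ p * (ρ / ρ') ^ N) * ρ' ^ N := by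
            rw [div_pow]; field_simp
        _ ≤ 1 * ρ' ^ N := mul_le_mul_of_nonneg_right hbound (by positivity)
        _ = ρ' ^ N := one_mul _
    calc c N ^ (1 / (N : ℝ)) ≤ (ρ' ^ N) ^ (1 / (N : ℝ)) :=
          Real.rpow_le_rpow (hc N) hcN (by positivity)
      _ = ρ' := by rw [one_div, Real.pow_rpow_inv_natCast hρ'0.le (by omega)]
  exact Filter.limsup_le_of_le (Filter.isCoboundedUnder_le_of_le atTop fun N => Real.rpow_nonneg (hc N) _) hev

/-- For an `ℕ∞`-valued sequence, `limsup < ∞` means eventually bounded. [folklore] -/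
private theorem exists_bound_of_limsup_lt_top {g : ℕ → ℕ∞} (h : Filter.limsup g atTop < ⊤) :
    ∃ a T : ℕ, ∀ x : ℕ, a ≤ x → g x ≤ (T : ℕ∞) := by
  rw [Filter.limsup_eq_iInf_iSup_of_nat] at h
  obtain ⟨a, ha⟩ := iInf_lt_iff.1 h
  obtain ⟨T, hT⟩ := ENat.ne_top_iff_exists.1 ha.ne
  refine ⟨a, T, fun x hx => ?_⟩
  rw [hT]
  exact le_iSup₂ (f := fun i (_ : i ≥ a) => g i) x hx

/-- A coordinate bound from the wedge: `x ∈ 𝓡_f`, `f_j(x₁) ≤ G` ⇒ `0 ≤ x_j ≤ G`. [cite: MadrasSlade1993, §8.2, Theorem 8.2.3 (definition of `𝓡_f`)] -/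
private theorem coord_le_of_profile_le [NeZero d] {f : Fin d → ℕ → ℕ∞} {x : Site d} (hx : x ∈ msWedge f) {j : Fin d}
    (hj : j ≠ 0) {G : ℕ} (hG : f j (x 0).toNat ≤ (G : ℕ∞)) : 0 ≤ x j ∧ x j ≤ (G : ℤ) := by
  obtain ⟨-, hxj⟩ := hx
  obtain ⟨h0, hjf⟩ := hxj j hj
  refine ⟨h0, ?_⟩
  have h2 : ((x j).toNat : ℕ∞) ≤ (G : ℕ∞) := hjf.trans hG
  have h3 : (x j).toNat ≤ G := by exact_mod_cast h2
  exact Int.toNat_le.1 h3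

/-! ### An everywhere bounded profile: the wedge lies in a slab -/

/-- If `f_i(x) ≤ T` for every `x`, then `c_N⟨𝓡_f⟩ ≤ c_N(R[d-1,T])`. [cite: MadrasSlade1993, §8.2, Theorem 8.2.3 (a) and eq. (8.2.11) (a wedge with a bounded profile lies in a slab)] -/
theorem regionCount_msWedge_le_tubeCount [NeZero d] (f : Fin d → ℕ → ℕ∞) {i : Fin d} (hi : i ≠ 0) {T : ℕ}
    (hfi : ∀ x : ℕ, f i x ≤ (T : ℕ∞)) (N : ℕ) : regionCount (msWedge f) N ≤ tubeCount d (d - 1) T N := by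
  classical
  have h0 : (0 : Site d) ∈ slabAt i T := by simp [slabAt]
  refine le_trans (Finset.card_le_card fun ω hω => ?_) (card_envWalks_slabAt_le (n := N) h0)
  obtain ⟨hs, hR⟩ := mem_regionWalks.1 hω
  refine Finset.mem_filter.2 ⟨hs, fun m hm => ?_⟩
  rw [zero_add, mem_slabAt]
  exact coord_le_of_profile_le (hR m hm) hi (hfi _)

/-! ### The cut separator -/

section Cut

variable [NeZero d] {f : Fin d → ℕ → ℕ∞} {i : Fin d} {a T c G : ℕ}

open Classical in
/-- The box `{c} × [0, G]^{d-1}` containing the cut set. [cite: MadrasSlade1993, §8.2, Theorem 8.2.3 (a) (this file's cut-separator proof)] -/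
def cutBox (c G : ℕ) : Finset (Site d) :=
  Fintype.piFinset fun j : Fin d => if j = 0 then {(c : ℤ)} else Finset.Icc (0 : ℤ) G

open Classical in
/-- The cut set: sites of `𝓡_f` on the slice `x₁ = c` whose right neighbour `v + e₁` is also in `𝓡_f` (inside the
box `{c} × [0,G]^{d-1}`). [cite: MadrasSlade1993, §8.2, Theorem 8.2.3 (a) (this file's cut-separator proof)] -/
def cutSet (f : Fin d → ℕ → ℕ∞) (c G : ℕ) : Finset (Site d) :=
  (cutBox c G).filter fun v => v ∈ msWedge f ∧ v + Pi.single 0 1 ∈ msWedge f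

/-- The separator: the cut set together with the origin. [cite: MadrasSlade1993, §8.2, Theorem 8.2.3 (a) (this file's cut-separator proof)] -/
def cutCorner (f : Fin d → ℕ → ℕ∞) (c G : ℕ) : Finset (Site d) := insert 0 (cutSet f c G)

/-- Membership in the cut box. [cite: MadrasSlade1993, §8.2, Theorem 8.2.3 (a) (this file's cut-separator proof)] -/
theorem mem_cutBox {v : Site d} : v ∈ (cutBox c G : Finset (Site d)) ↔ v 0 = c ∧ ∀ j : Fin d, j ≠ 0 → 0 ≤ v j ∧ v j ≤ (G : ℤ) := by
  classical
  rw [cutBox, Fintype.mem_piFinset]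
  constructor
  · intro h
    refine ⟨?_, fun j hj => ?_⟩
    · have := h 0; rw [if_pos rfl, Finset.mem_singleton] at this; exact this
    · have := h j; rw [if_neg hj, Finset.mem_Icc] at this; exact this
  · rintro ⟨h0, hj⟩ j
    by_cases hj0 : j = 0
    · subst hj0; rw [if_pos rfl, Finset.mem_singleton]; exact h0
    · rw [if_neg hj0, Finset.mem_Icc]; exact hj j hj0

/-- Membership in the cut set. [cite: MadrasSlade1993, §8.2, Theorem 8.2.3 (a) (this file's cut-separator proof)] -/
theorem mem_cutSet {v : Site d} : v ∈ cutSet f c G ↔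
    (v 0 = c ∧ ∀ j : Fin d, j ≠ 0 → 0 ≤ v j ∧ v j ≤ (G : ℤ)) ∧ v ∈ msWedge f ∧ v + Pi.single 0 1 ∈ msWedge f := by
  classical
  rw [cutSet, Finset.mem_filter, mem_cutBox]

/-- **The cut set catches every edge across the cut.** If `f_i ≤ T ≤ G` beyond `a ≤ c` and every other profile is
`≤ G` on one of the slices `c`, `c+1`, then a site `y ∈ 𝓡_f` with `y₁ = c` and `y + e₁ ∈ 𝓡_f` belongs to the cut
set. [cite: MadrasSlade1993, §8.2, Theorem 8.2.3 (a) (this file's cut-separator proof)] -/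
theorem mem_cutSet_of_adj (hi : i ≠ 0) (hfi : ∀ x : ℕ, a ≤ x → f i x ≤ (T : ℕ∞)) (hac : a ≤ c) (hTG : T ≤ G)
    (hG : ∀ j : Fin d, j ≠ 0 → j ≠ i → f j c ≤ (G : ℕ∞) ∨ f j (c + 1) ≤ (G : ℕ∞))
    {y : Site d} (hy : y ∈ msWedge f) (hy0 : y 0 = c) (hy' : y + Pi.single 0 1 ∈ msWedge f) :
    y ∈ cutSet f c G := by
  have hy'0 : (y + Pi.single 0 1 : Site d) 0 = (c : ℤ) + 1 := by simp [hy0]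
  have hc0 : ((y 0).toNat) = c := by rw [hy0]; simp
  have hc1 : ((y + Pi.single 0 1 : Site d) 0).toNat = c + 1 := by rw [hy'0]; omega
  refine mem_cutSet.2 ⟨⟨hy0, fun j hj => ?_⟩, hy, hy'⟩
  by_cases hji : j = i
  · subst hji
    have h1 : f j ((y + Pi.single 0 1 : Site d) 0).toNat ≤ (G : ℕ∞) := by
      rw [hc1]; exact (hfi _ (by omega)).trans (by exact_mod_cast hTG)
    have := coord_le_of_profile_le hy' hj h1
    simpa [Pi.single_eq_of_ne hj] using this
  · rcases hG j hj hji with h | h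
    · exact coord_le_of_profile_le hy hj (by rw [hc0]; exact h)
    · have := coord_le_of_profile_le hy' hj (by rw [hc1]; exact h)
      simpa [Pi.single_eq_of_ne hj] using this

/-- **The corner structure given by a fjord-free cut.** [cite: MadrasSlade1993, §8.2, Theorem 8.2.3 (a) (this file's cut-separator proof)] -/
theorem cornerData_cut (hi : i ≠ 0) (hfi : ∀ x : ℕ, a ≤ x → f i x ≤ (T : ℕ∞)) (hac : a ≤ c) (hTG : T ≤ G)
    (hG : ∀ j : Fin d, j ≠ 0 → j ≠ i → f j c ≤ (G : ℕ∞) ∨ f j (c + 1) ≤ (G : ℕ∞)) :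
    CornerData (msWedge f) (cutCorner f c G)
      {x | x ∈ msWedge f ∧ (c : ℤ) + 1 ≤ x 0}
      {x | x ∈ msWedge f ∧ x 0 ≤ (c : ℤ) ∧ x ∉ (cutCorner f c G : Finset (Site d))}
      (slabAt i T) (slabAt 0 c) where
  zero_mem := Finset.mem_insert_self _ _
  cover x hx hxB := by
    by_cases h : (c : ℤ) + 1 ≤ x 0
    · exact Or.inl ⟨hx, h⟩
    · exact Or.inr ⟨hx, by omega, fun h' => hxB (Finset.mem_coe.2 h')⟩
  sep := by
    rintro x ⟨hx, hxc⟩ y ⟨hy, hyc, hyB⟩ hadj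
    apply hyB
    obtain ⟨j, hj⟩ := (zdGraph_adj_iff x y).1 hadj
    rcases hj with hxy | hxy
    · exfalso
      have : x 0 ≤ y 0 := by
        rw [hxy, Pi.add_apply]
        by_cases hj0 : j = 0
        · subst hj0; simp
        · rw [Pi.single_eq_of_ne (Ne.symm hj0)]; simp
      omega
    · by_cases hj0 : j = 0
      · subst hj0
        have hy0 : y 0 = c := by
          have := congrFun hxy 0; simp only [Pi.add_apply, Pi.single_eq_same] at this; omega
        have hx' : y + Pi.single 0 1 ∈ msWedge f := hxy ▸ hx
        exact Finset.mem_coe.2 (Finset.mem_insert_of_mem (mem_cutSet_of_adj hi hfi hac hTG hG hy hy0 hx'))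
      · exfalso
        have : x 0 = y 0 := by rw [hxy, Pi.add_apply, Pi.single_eq_of_ne (Ne.symm hj0) , add_zero]
        omega
  sub₀ := by
    rintro x ⟨hx, hxc⟩
    rw [mem_slabAt]
    refine coord_le_of_profile_le hx hi (hfi _ ?_)
    have : (a : ℤ) ≤ x 0 := by omega
    rw [Int.le_toNat hx.1]; exact this
  sub₁ := by
    rintro x ⟨hx, hxc, -⟩
    exact ⟨hx.1, hxc⟩
  corner₀ x hx := by
    rcases Finset.mem_insert.1 (Finset.mem_coe.1 hx) with rfl | hx
    · simp [slabAt]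
    · obtain ⟨⟨hv0, hvj⟩, -, -⟩ := mem_cutSet.1 hx
      have := hvj i hi
      rw [mem_slabAt]
      -- the bound `v_i ≤ T` comes from the right neighbour, on the slice `c + 1 ≥ a`
      obtain ⟨-, -, hv'⟩ := mem_cutSet.1 hx
      have hc1 : ((x + Pi.single 0 1 : Site d) 0).toNat = c + 1 := by simp [hv0]
      have h1 := coord_le_of_profile_le hv' hi (G := T) (by rw [hc1]; exact hfi _ (by omega))
      simpa [Pi.single_eq_of_ne hi] using h1
  corner₁ x hx := by
    rcases Finset.mem_insert.1 (Finset.mem_coe.1 hx) with rfl | hx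
    · simp [slabAt]
    · obtain ⟨⟨hv0, -⟩, hv, -⟩ := mem_cutSet.1 hx
      exact ⟨hv.1, hv0.le⟩

/-- **Quantitative Theorem 8.2.3 (a) with a fjord-free cut** (`d ≥ 2`): `c_N⟨𝓡_f⟩ ≤ C (N+1)^p ρ^N` for every
`ρ > max(μ(R[d-1,T]), μ(R[d-1,c]))`. [cite: MadrasSlade1993, §8.2, Theorem 8.2.3 (a) (this file's cut-separator proof)] -/
theorem regionCount_msWedge_le_mul_pow_cut (hd : 2 ≤ d) (hi : i ≠ 0) (hfi : ∀ x : ℕ, a ≤ x → f i x ≤ (T : ℕ∞))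
    (hac : a ≤ c) (hTG : T ≤ G) (hG : ∀ j : Fin d, j ≠ 0 → j ≠ i → f j c ≤ (G : ℕ∞) ∨ f j (c + 1) ≤ (G : ℕ∞))
    {ρ : ℝ} (hρ₀ : tubeConnectiveConstant d (d - 1) T < ρ) (hρ₁ : tubeConnectiveConstant d (d - 1) c < ρ) :
    ∃ C : ℝ, 0 < C ∧ ∀ N : ℕ, (regionCount (msWedge f) N : ℝ) ≤
      C * ((N : ℝ) + 1) ^ ((cutCorner f c G).card + 1) * ρ ^ N := by
  have hcd := cornerData_cut hi hfi hac hTG hG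
  have hk : 1 ≤ d - 1 := by omega
  have hρpos : 0 < ρ := (tubeConnectiveConstant_pos (d := d) hk T).trans hρ₀
  obtain ⟨D₀, hD₀, hD₀b⟩ := exists_tubeCount_le_mul_pow (d := d) hk T hρ₀
  obtain ⟨D₁, hD₁, hD₁b⟩ := exists_tubeCount_le_mul_pow (d := d) hk c hρ₁
  set B : Finset (Site d) := cutCorner f c G with hB
  have hBpos : (1 : ℝ) ≤ B.card := by
    exact_mod_cast Finset.card_pos.2 ⟨0, hcd.zero_mem⟩
  set M : ℝ := B.card * (D₀ + D₁) with hM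
  have hM1 : 1 ≤ M := by rw [hM]; nlinarith
  have hpcs : ∀ n, ((pcs B (slabAt i T) (slabAt 0 c) n).card : ℝ) ≤ M * ρ ^ n := fun n => by
    calc ((pcs B (slabAt i T) (slabAt 0 c) n).card : ℝ)
        ≤ ∑ b ∈ B, (((envWalks (slabAt i T) b n).card : ℝ) + (envWalks (slabAt 0 c) b n).card) := by
          exact_mod_cast card_pcs_le n
      _ ≤ ∑ _b ∈ B, (D₀ * ρ ^ n + D₁ * ρ ^ n) := by
          refine Finset.sum_le_sum fun b hb => add_le_add ?_ ?_
          · have hbT : b ∈ slabAt i T := hcd.corner₀ (Finset.mem_coe.2 hb)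
            exact (Nat.cast_le.2 (card_envWalks_slabAt_le hbT)).trans (hD₀b n)
          · have hbS : b ∈ slabAt 0 c := hcd.corner₁ (Finset.mem_coe.2 hb)
            exact (Nat.cast_le.2 (card_envWalks_slabAt_le hbS)).trans (hD₁b n)
      _ = M * ρ ^ n := by rw [Finset.sum_const, nsmul_eq_mul, hM]; ring
  refine ⟨((B.card : ℝ) + 1) * M ^ (B.card + 1), by positivity, fun N => ?_⟩
  have := CornerDecomp.card_regionWalks_le_pow hcd hM1 hρpos hpcs N
  linarith [this]

end Cut

end CutSeparator

/-! ### The theorems -/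

section Theorems

variable [NeZero d]

open CutSeparator CornerDecomp

/-- **Theorem 8.2.3 (a), everywhere bounded profile** (`d ≥ 2`): if `f_i(x) ≤ T` for EVERY `x` (one `i ≠ 0`; the
other profiles arbitrary, `∞` allowed), then `limsup c_N⟨𝓡_f⟩^{1/N} ≤ μ(R[d-1,T]) < μ` — the wedge lies in a slab
and (8.2.11) applies. [cite: MadrasSlade1993, Theorem 8.2.3 (a) (p. 271); eq. (8.2.11) (p. 269)] -/
theorem MadrasSlade1993_thm823a_of_bounded (hd : 2 ≤ d) (f : Fin d → ℕ → ℕ∞) {i : Fin d} (hi : i ≠ 0) {T : ℕ}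
    (hfi : ∀ x : ℕ, f i x ≤ (T : ℕ∞)) :
    Filter.limsup (fun N : ℕ => (regionCount (msWedge f) N : ℝ) ^ (1 / (N : ℝ))) atTop <
      connectiveConstant d := by
  have hk : 1 ≤ d - 1 := by omega
  have hlt := tubeConnectiveConstant_lt_connectiveConstant (d := d) (k := d - 1) hk (by omega) T
  set ρ := (tubeConnectiveConstant d (d - 1) T + connectiveConstant d) / 2 with hρ
  have hρ₀ : tubeConnectiveConstant d (d - 1) T < ρ := by rw [hρ]; linarith
  have hρμ : ρ < connectiveConstant d := by rw [hρ]; linarith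
  have hρpos : 0 < ρ := (tubeConnectiveConstant_pos (d := d) hk T).trans hρ₀
  obtain ⟨D, hD, hDb⟩ := exists_tubeCount_le_mul_pow (d := d) hk T hρ₀
  have hbound : ∀ N, (regionCount (msWedge f) N : ℝ) ≤ D * ((N : ℝ) + 1) ^ 0 * ρ ^ N := fun N => by
    rw [pow_zero, mul_one]
    exact (Nat.cast_le.2 (regionCount_msWedge_le_tubeCount f hi hfi N)).trans (hDb N)
  exact (CutSeparator.limsup_rpow_le_of_le_mul_pow (fun N => Nat.cast_nonneg _) hρpos hbound).trans_lt hρμ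

/-- **Theorem 8.2.3 (a) with a fjord-free cut** (`d ≥ 2`): profile `i` satisfies `f_i(x) ≤ T` for `x ≥ a`, and at
some cut `c | c+1` with `c ≥ a` no other profile is infinite on both slices (`f_j(c) ≠ ∞ ∨ f_j(c+1) ≠ ∞`). Then
`limsup c_N⟨𝓡_f⟩^{1/N} < μ`. (Corner decomposition with the finite separator `{0} ∪ {v ∈ 𝓡_f : v₁ = c, v + e₁ ∈ 𝓡_f}`
onto the slabs `{0 ≤ x_i ≤ T}` and `{0 ≤ x₁ ≤ c}`, both of connective constant `< μ` by (8.2.11); not the printed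
Pattern-Theorem proof.) [cite: MadrasSlade1993, Theorem 8.2.3 (a) (p. 271)] -/
theorem MadrasSlade1993_thm823a_of_cut (hd : 2 ≤ d) (f : Fin d → ℕ → ℕ∞) {i : Fin d} (hi : i ≠ 0) {a T c : ℕ}
    (hfi : ∀ x : ℕ, a ≤ x → f i x ≤ (T : ℕ∞)) (hac : a ≤ c)
    (hcut : ∀ j : Fin d, j ≠ 0 → j ≠ i → f j c ≠ ⊤ ∨ f j (c + 1) ≠ ⊤) :
    Filter.limsup (fun N : ℕ => (regionCount (msWedge f) N : ℝ) ^ (1 / (N : ℝ))) atTop <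
      connectiveConstant d := by
  classical
  -- a common finite bound `G ≥ T` at the cut
  have hGj : ∀ j : Fin d, ∃ g : ℕ, j ≠ 0 → j ≠ i → f j c ≤ (g : ℕ∞) ∨ f j (c + 1) ≤ (g : ℕ∞) := fun j => by
    by_cases hj0 : j = 0
    · exact ⟨0, fun h => absurd hj0 h⟩
    by_cases hji : j = i
    · exact ⟨0, fun _ h => absurd hji h⟩
    rcases hcut j hj0 hji with h | h
    · obtain ⟨g, hg⟩ := ENat.ne_top_iff_exists.1 h
      exact ⟨g, fun _ _ => Or.inl (by rw [← hg])⟩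
    · obtain ⟨g, hg⟩ := ENat.ne_top_iff_exists.1 h
      exact ⟨g, fun _ _ => Or.inr (by rw [← hg])⟩
  choose g hg using hGj
  set G : ℕ := T + Finset.univ.sup g with hGdef
  have hTG : T ≤ G := by omega
  have hG : ∀ j : Fin d, j ≠ 0 → j ≠ i → f j c ≤ (G : ℕ∞) ∨ f j (c + 1) ≤ (G : ℕ∞) := fun j hj0 hji => by
    have hgG : (g j : ℕ∞) ≤ (G : ℕ∞) := by
      have : g j ≤ Finset.univ.sup g := Finset.le_sup (Finset.mem_univ j)
      exact_mod_cast (show g j ≤ G by omega)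
    rcases hg j hj0 hji with h | h
    · exact Or.inl (h.trans hgG)
    · exact Or.inr (h.trans hgG)
  obtain ⟨ρ, hρμ, hρ₀, hρ₁⟩ :
      ∃ ρ : ℝ, ρ < connectiveConstant d ∧ tubeConnectiveConstant d (d - 1) T < ρ ∧
        tubeConnectiveConstant d (d - 1) c < ρ := by
    have h0 := tubeConnectiveConstant_lt_connectiveConstant (d := d) (k := d - 1) (by omega) (by omega) T
    have h1 := tubeConnectiveConstant_lt_connectiveConstant (d := d) (k := d - 1) (by omega) (by omega) c
    refine ⟨(max (tubeConnectiveConstant d (d - 1) T) (tubeConnectiveConstant d (d - 1) c) +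
      connectiveConstant d) / 2, ?_, ?_, ?_⟩
    · have := max_lt h0 h1; linarith
    · have := le_max_left (tubeConnectiveConstant d (d - 1) T) (tubeConnectiveConstant d (d - 1) c)
      linarith [max_lt h0 h1]
    · have := le_max_right (tubeConnectiveConstant d (d - 1) T) (tubeConnectiveConstant d (d - 1) c)
      linarith [max_lt h0 h1]
  have hρpos : 0 < ρ := (tubeConnectiveConstant_pos (d := d) (k := d - 1) (by omega) T).trans hρ₀
  obtain ⟨C, hC, hbound⟩ := regionCount_msWedge_le_mul_pow_cut hd hi hfi hac hTG hG hρ₀ hρ₁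
  exact (CutSeparator.limsup_rpow_le_of_le_mul_pow (fun N => Nat.cast_nonneg _) hρpos hbound).trans_lt hρμ

/-- **Theorem 8.2.3 (a) with the printed hypothesis on one profile and fjord-free cuts beyond every threshold**
(`d ≥ 2`): if `limsup f_i < ∞` (`i ≠ 0`) and for infinitely many `c` no other profile takes the value `∞` on both
slices `c`, `c+1`, then `limsup c_N⟨𝓡_f⟩^{1/N} < μ`. Contains the finite-valued case
(`MadrasSlade1993_thm823a_of_ne_top`). The residual printed case — beyond some point every cut blocked by a profile
infinite on both of its slices — is a Pattern-Theorem statement not covered here.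
[cite: MadrasSlade1993, Theorem 8.2.3 (a) (p. 271; printed proof "immediate consequence of the Pattern Theorem" — not the proof formalised); Notes §8.5 (p. 278: due to Hammersley–Whittington 1985)] -/
theorem MadrasSlade1993_thm823a_of_frequently_cut (hd : 2 ≤ d) (f : Fin d → ℕ → ℕ∞) {i : Fin d} (hi : i ≠ 0)
    (hfi : Filter.limsup (f i) atTop < ⊤)
    (hcut : ∃ᶠ c in atTop, ∀ j : Fin d, j ≠ 0 → j ≠ i → f j c ≠ ⊤ ∨ f j (c + 1) ≠ ⊤) :
    Filter.limsup (fun N : ℕ => (regionCount (msWedge f) N : ℝ) ^ (1 / (N : ℝ))) atTop <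
      connectiveConstant d := by
  obtain ⟨a, T, haT⟩ := CutSeparator.exists_bound_of_limsup_lt_top hfi
  obtain ⟨c, hc, hac⟩ := (hcut.and_eventually (eventually_ge_atTop a)).exists
  exact MadrasSlade1993_thm823a_of_cut hd f hi haT hac hc

end Theorems

end Literature.Probability.RandomPlanarGeometry.SAW.Zd

end
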